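import Mathlib
import Literature.Computability.MetaComplexity.ClosurePieceGame
import HarnessLib

/-!
# Plays of the closure piece game: maximal root paths, terminal endings, tree-likeness, path laws

Topic `Literature/Computability/MetaComplexity`; a follow-up to `ClosurePieceGame.lean` and, like it,
VOCABULARY ONLY — nothing in this file is a claim.  That file defines the position DAG of the closure
piece game of a parity decision DAG `G : ParityDag n h N` at rate `θ`, budget `D`, against a legal
oblivious demand rule `δ` (`ParityDag.Adj`, `IsRootPath`, `IsBlocking`, `pieceMass`, `HasCutFloor`).
Summit-side theses about the MIN-CUT FLOOR of that game (the Menger / max-flow–min-cut reading of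
dag-like lifting: "every blocking set of the position DAG is `Φ`-heavy" is the CUT side, "some
randomised Mover keeps its pieces dense along most plays" is the FLOW side) need four more words, added
here on the same carriers `GameVertex n h N` / `ParityDag.Adj`:

* `ParityDag.IsMaxRootPath` — a root path whose last vertex admits no move (a *play*; this is exactly
  the hypothesis shape quantified inside `IsBlocking`);
* `ParityDag.EndsAtTerminals` — every maximal root path ends at a terminal `Sum.inr (P, c)` ("no dead
  ends": the Mover is never stuck at a position, i.e. no good sink is reached and no demanded class is
  empty — the conclusion of the extractor / Atserias–Dalmau consistency step of the programme, named so
  that theses can file it as an item);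
* `ParityDag.IsTreeLike` — every node has at most one parent (the DAGs of tree-like `Res(⊕)`
  refutations; the rung on which cut floors are classical);
* `ParityDag.PathLaw` with `visit`, `logDensity`, `pathMax`, `Lambda` — a RANDOMISED MOVER STRATEGY
  presented as a finitely supported probability law `p` on maximal root paths (a unit flow out of the
  root, Schrijver's path decomposition of a flow), its visit probabilities `q_p(x)`, the log-density
  `log₂⁺ (q_p(x)·|Ω_{n,h}| / Φ(x))` of a vertex against the closure-corrected piece mass
  `Φ = pieceMass`, the maximum of the log-density along a play, and the path-law functional
  `Λ(p) := E_{P∼p}[max_{x∈P} log-density(x)]`.  `Λ` is the primal (flow) side of the LP duality whose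
  dual (cut) side is `HasCutFloor`: by the first-hit inequality and Jensen a path law certifies
  `Σ_{x∈X} Φ(x) ≥ 2^{-Λ(p)}·|Ω|` for every blocking set `X` (a summit-side item, NOT proved here).  The
  random walk on the affine DAG steered through closure assignments (Alekseev–Itsykson 2025, §3;
  Bhattacharya–Chattopadhyay 2025, §5) is one path law.

Conventions.  Paths are vertex lists as in `IsRootPath`; `visit` sums `prob` over the supported plays
containing the vertex (the move relation is acyclic on reachable vertices, so a play visits a vertex at
most once and this is the visit probability); `logDensity` is `max 0 (Real.logb 2 _)` with Mathlib's
junk value `x / 0 = 0` (so it is `0` where `Φ = 0`); `pathMax` of the empty list is `0`; `Lambda` is a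
finite sum.  Finite bookkeeping over `ℝ`, no measure theory.

## References

* [AlekseevItsykson2025] Y. Alekseev, D. Itsykson, *Lifting to bounded-depth and regular resolutions
  over parities via games*, STOC 2025, §3 (random-walk strategies on the affine DAG).
* [BhattacharyaChattopadhyay2025] S. Bhattacharya, A. Chattopadhyay, *Exponential lower bounds on the
  size of ResLin proofs of nearly quadratic depth*, arXiv:2507.23008, §5–6.
* [GargEtAl2020] A. Garg, M. Göös, P. Kamath, D. Sokolov, *Monotone circuit lower bounds from
  resolution*, Theory Comput. 16 (2020) (dag-like lifting; adversary strategies from width).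
-/

namespace Literature.Computability.MetaComplexity

open Complexity Finset

noncomputable section
open scoped Classical

namespace ParityDag

variable {n h N : ℕ}

/-- A MAXIMAL ROOT PATH (a play of the closure piece game): a root path whose last vertex admits no
move. [folklore] -/
def IsMaxRootPath (G : ParityDag n h N) (θ D : ℕ)
    (δ : Finset (Literal ℕ) → Finset (Fin n) → (Fin n → Bool)) (l : List (GameVertex n h N)) : Prop :=
  G.IsRootPath θ D δ l ∧ ∀ v, l.getLast? = some v → ∀ w, ¬ G.Adj θ D δ v w

/-- NO DEAD ENDS: every maximal root path ends at a terminal `Sum.inr (P, c)` (the Mover is never stuck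
at a position). [folklore] -/
def EndsAtTerminals (G : ParityDag n h N) (θ D : ℕ)
    (δ : Finset (Literal ℕ) → Finset (Fin n) → (Fin n → Bool)) : Prop :=
  ∀ l, G.IsMaxRootPath θ D δ l → ∀ v, l.getLast? = some v → v.isRight = true

/-- TREE-LIKE: every node has at most one parent. [folklore] -/
def IsTreeLike (G : ParityDag n h N) : Prop :=
  ∀ u u' c : Fin N, c ∈ G.children u → c ∈ G.children u' → u = u'

/-- A PATH LAW (randomised Mover strategy; a unit flow out of the root given by its path
decomposition): a finitely supported probability distribution on maximal root paths of the position
DAG. [cite: AlekseevItsykson2025, §3 (random-walk strategies on the affine DAG)] -/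
structure PathLaw (G : ParityDag n h N) (θ D : ℕ)
    (δ : Finset (Literal ℕ) → Finset (Fin n) → (Fin n → Bool)) where
  /-- the support: finitely many plays -/
  supp : Finset (List (GameVertex n h N))
  /-- the probability of a play -/
  prob : List (GameVertex n h N) → ℝ
  prob_nonneg : ∀ l, 0 ≤ prob l
  prob_eq_zero : ∀ l, l ∉ supp → prob l = 0
  prob_sum : ∑ l ∈ supp, prob l = 1
  maximal : ∀ l ∈ supp, G.IsMaxRootPath θ D δ l

namespace PathLaw

variable {G : ParityDag n h N} {θ D : ℕ} {δ : Finset (Literal ℕ) → Finset (Fin n) → (Fin n → Bool)}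

/-- The VISIT PROBABILITY `q_p(x) := p {P | x ∈ P}`. [folklore] -/
def visit (p : G.PathLaw θ D δ) (x : GameVertex n h N) : ℝ :=
  ∑ l ∈ p.supp.filter (fun l => x ∈ l), p.prob l

/-- The LOG-DENSITY of a vertex under `p` against the piece mass:
`log₂⁺ (q_p(x) · |Ω_{n,h}| / Φ(x))`. [folklore] -/
def logDensity (p : G.PathLaw θ D δ) (x : GameVertex n h N) : ℝ :=
  max 0 (Real.logb 2 (p.visit x * Nat.card (IPOmega n h) / G.pieceMass θ D δ x))

/-- The maximum of the log-density along a vertex list (`0` on the empty list). [folklore] -/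
def pathMax (p : G.PathLaw θ D δ) (l : List (GameVertex n h N)) : ℝ :=
  (l.map p.logDensity).foldr max 0

/-- The PATH-LAW FUNCTIONAL `Λ(p) := E_{P ∼ p} [max_{x ∈ P} log-density(x)]` — the flow side of the
min-cut floor. [folklore] -/
def Lambda (p : G.PathLaw θ D δ) : ℝ :=
  ∑ l ∈ p.supp, p.prob l * p.pathMax l

end PathLaw

end ParityDag

end

end Literature.Computability.MetaComplexity
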